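import Summits.ABC.IUTFork.Thm311RealInd1StripTwistMoverJW
import Summits.ABC.IUTFork.Thm311RealInd1StripRigid
import Summits.ABC.IUTFork.Thm311RealGaloisLogAnalytic
import Literature.AnabelianGeometry.AbsoluteAnabelian.MLFGaloisDehnTwistTransvections
import HarnessLib

/-!
# [IUTchIII] Thm 3.11 (i) (Ind1) at `v ∈ 𝕍^non`: the twist MOVER over the FAITHFUL (unit-restricted) Jannsen–Wingberg fact

PROOF-ONLY file (abc-iut cell, Cor. 3.12 sub-crew, seat abc-iut-c312-1 = holder of record of the typed [IUTchIII] Thm. 3.11,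
gen 9; row «R10 IND1-STRIP-MOVER-JW», ERRATUM of the same session).  TAKES NO SIDE on [IUTchIII] Cor. 3.12.

WHY THIS FILE.  My `Thm311RealInd1StripTwistMoverJW` (p470354) takes the named fact `DehnTwistTransvections` as binder; that
fact (p469197) turned out to be OVER-QUANTIFIED — its predicate `MLFClosure.LiftActsOnLogAs` also constrains the IWASAWA
logarithms of NON-units, which K. Kondo (arXiv:2512.09231 §2) does not assert (`k_+ = (𝒪_k^×)^{pf} ⊗ ℚ` is about units only).
The faithful fact is `DehnTwistTransvectionsOnUnits` over `MLFClosure.LiftActsOnUnitLogAs` (same Literature file, appended).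
Since the bridge only ever evaluates the predicate at UNITS `toOUnits v u`, the whole chain re-derives verbatim from the
faithful fact:
* `Real.realises_galoisLog_of_liftActsOnUnitLogAs` — unit-restricted action `⟹` `Real.Realises` through `Real.galoisLog v`;
* **`Real.exists_mem_ind1StripOf_galoisLog_image_closedBall_ne_of_dehnTwistsOnUnits`** — ASSUMING
  `DehnTwistTransvectionsOnUnits`: at every `v ∣ p` with `p` odd, `f(v|p) = 1`, `e(v|p) ≥ 3` some
  `χ ∈ Real.ind1StripOf v (Real.galoisLog v)` and `m ∈ ℤ` have `χ(B(0,‖ϖ‖^m)) ≠ B(0,‖ϖ‖^m)`;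
* `…_analyticLogv_…_of_dehnTwistsOnUnits` — the same over abc-iut-c312-5's `analyticLogv F v` (w5-d216
  `galoisLog_eq_analyticLogv`).
These SUPERSEDE the `_of_dehnTwists` theorems of p470354 / p470502 as the statements of record (those remain true but are
conditional on a hypothesis stronger than print).  HONEST SCOPE as before: conditional on a named classical fact (NSW
Thm. 7.5.14 + Kondo §2), a statement about OUR typed objects at ONE place; nothing here asserts or refutes [IUTchIII]
Cor. 3.12.  [claim: Mochizuki2012, status: disputed]; [cite: Kondo2025OuterAutMLF, §2 Thm 2.1 and proof of Thm 2.3 p.10];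
[cite: NeukirchSchmidtWingberg2008, Thm 7.5.14]; [cite: DupuyHilado2025, §4.7].  typed ≠ proved.
-/

set_option autoImplicit false

noncomputable section

open Metric Set
open scoped Pointwise

namespace Summit.ABC.IUTFork.Thm311.Real

open NumberField IsDedekindDomain Literature.NumberTheory.NumberFields Literature.IUT.LogVolume
open Literature.NumberTheory.GaloisRepresentations Literature.NumberTheory.GaloisRepresentations.Ultrametric
open Literature.AnabelianGeometry.AbsoluteAnabelian Literature.IUT.HodgeArakelov
open Literature.IUT.HodgeArakelov.AbsTopMonoids

variable {F : Type} [Field F] [NumberField F] (v : HeightOneSpectrum (𝓞 F))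

/-- **Acting as `T` on UNIT logarithms (faithful fact) ⟹ REALISING through the Galois logarithm.**  If THE lift of
`φ ∈ Aut_top(G_v)` acts on base units, read through `log_k̄`, as the map `T` of `K_v`
(`MLFClosure.LiftActsOnUnitLogAs (closureAt v) p_v _ φ T`), then any additive automorphism `ψ` of `K_v` agreeing with `T`
realises `stripMulAut v φ` through `Real.galoisLog v`: `ψ (log u) = log (liftUnits v φ u)` for all `u ∈ 𝒪_v^×`.
[claim: Mochizuki2012, status: disputed] -/
theorem realises_galoisLog_of_liftActsOnUnitLogAs [Fact (closureAt v).residueChar.Prime]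
    (hp : ValuativeRel.valuation (v.adicCompletion F) (closureAt v).residueChar < 1)
    (φ : Gal v ≃ₜ* Gal v) (T : v.adicCompletion F → v.adicCompletion F)
    (hφ : (closureAt v).LiftActsOnUnitLogAs (closureAt v).residueChar hp φ T)
    (ψ : v.adicCompletion F ≃+ v.adicCompletion F) (hψ : ∀ x, ψ x = T x) :
    Realises v (galoisLog v) (stripMulAut v φ) ψ := by
  rw [realises_stripMulAut_iff]
  intro u
  rw [hψ]
  symm
  refine hφ ((toOUnits v u : OUnits v) : nonzeroIntegers (v.adicCompletion F) (AlgebraicClosure (v.adicCompletion F)))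
    ((toOUnits v (liftUnits v φ u) : OUnits v) :
      nonzeroIntegers (v.adicCompletion F) (AlgebraicClosure (v.adicCompletion F)))
    ((u : ↥(v.adicCompletionIntegers F)) : v.adicCompletion F)
    ((liftUnits v φ u : ↥(v.adicCompletionIntegers F)) : v.adicCompletion F)
    (galoisLog v (Additive.ofMul u)) (galoisLog v (Additive.ofMul (liftUnits v φ u))) (Units.isUnit _)
    (val_toOUnits v u) (val_toOUnits v (liftUnits v φ u)) ?_ ?_ ?_
  · -- THE lift maps the image of `u` to the image of `liftUnits v φ u` (`coe_liftM_toOUnits`)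
    apply Subtype.ext
    rw [coe_liftM_toOUnits]
    exact (val_toOUnits v (liftUnits v φ u)).symm
  · exact (algebraMap_galoisLog v u).symm
  · exact (algebraMap_galoisLog v (liftUnits v φ u)).symm

/-- **PRINT'S (Ind1) STRIP PART MOVES A BALL at every `v ∣ p` with `p` odd, `f(v|p) = 1`, `e(v|p) ≥ 3` — modulo the
FAITHFUL Jannsen–Wingberg twist fact.**  Assume `DehnTwistTransvectionsOnUnits` (Kondo arXiv:2512.09231 §2 / NSW Thm. 7.5.14, unit-restricted).  Let
`v` be a finite place of the number field `F` over the odd prime `p` with `f(v|p) = 1` and `e(v|p) ≥ 3`, `K_v` read in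
abc-iut-S7's rescaled norm, `ϖ` a uniformizer.  Then there are `χ ∈ Real.ind1StripOf v (Real.galoisLog v)` (print's (Ind1)
strip part at `v`, through THE equivariant lift and the Galois `p`-adic logarithm) and `m ∈ ℤ` with
`χ(B(0,‖ϖ‖^m)) ≠ B(0,‖ϖ‖^m)`: an ideal-shaped region of the real log-shell carrier is MOVED.  (The twists give a
`ℚ_p`-basis `y` and `a ≠ b` with realised transvections `x ↦ x + y^*_b(x)·y_a`, `x ↦ x − y^*_a(x)·y_b`
— `realises_galoisLog_of_liftActsOnUnitLogAs` —, continuous as linear maps of the finite-dimensional `ℚ_p`-space `K_v`;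
then `exists_mem_ind1StripOf_image_closedBall_ne`.)  Contrast: print's (Ind2) moves no ball
(`image_closedBall_eq_of_mem_ismIsm`); Dupuy–Hilado's (Ind1) is `{1}`. [claim: Mochizuki2012, status: disputed]
[cite: Kondo2025OuterAutMLF, §2 Thm 2.1 and proof of Thm 2.3 p.10] [cite: DupuyHilado2025, §4.7] -/
theorem exists_mem_ind1StripOf_galoisLog_image_closedBall_ne_of_dehnTwistsOnUnits (hJW : DehnTwistTransvectionsOnUnits)
    (p : ℕ) [Fact p.Prime] (hv : ((p : ℕ) : 𝓞 F) ∈ v.asIdeal) (hp2 : p ≠ 2)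
    (hf : v.asIdeal.inertiaDeg ℤ = 1) (he : 3 ≤ v.asIdeal.ramificationIdx ℤ)
    {ϖ : (RescaledCompletion F p v hv)ˣ} (hϖ : IsUniformizer ϖ) :
    ∃ χ ∈ ind1StripOf v (galoisLog v), ∃ m : ℤ,
      (fun x => RescaledCompletion.of F p v hv (χ ((RescaledCompletion.of F p v hv).symm x))) ''
          closedBall (0 : RescaledCompletion F p v hv) (‖(ϖ : RescaledCompletion F p v hv)‖ ^ m) ≠
        closedBall (0 : RescaledCompletion F p v hv) (‖(ϖ : RescaledCompletion F p v hv)‖ ^ m) := by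
  -- `p` IS the residue characteristic of `K_v`
  obtain rfl : p = (closureAt v).residueChar := eq_residueChar_closureAt_of_natCast_mem v hv
  have hpk : ValuativeRel.valuation (v.adicCompletion F) (closureAt v).residueChar < 1 :=
    LocalField.valuation_adicCompletion_natCast_lt_one v (closureAt v).residueChar hv
  -- the canonical `ℚ_p`-structure of `K_v` (the fact's `LocalField.padicAlgebra`; = abc-iut-S7's on the rescaled completion)
  haveI : CharZero (closureAt v).k := (closureAt v).instChar
  letI iQ : Algebra ℚ_[(closureAt v).residueChar] (closureAt v).k :=
    LocalField.padicAlgebra (closureAt v).k (closureAt v).residueChar hpk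
  -- `[K_v : ℚ_p] = e·f = e ≥ 3`
  have hfin : 3 ≤ Module.finrank ℚ_[(closureAt v).residueChar] (closureAt v).k := by
    have h : localDeg F v = Module.finrank ℚ_[(closureAt v).residueChar] (closureAt v).k := by
      exact RescaledCompletion.localDeg_eq_finrank F (closureAt v).residueChar v hv
    rw [localDeg, hf, mul_one] at h
    rw [← h]; exact he
  -- the twists
  obtain ⟨n, y, a, b, hab, ⟨φ, hφ⟩, ⟨φ', hφ'⟩⟩ := hJW (closureAt v) (closureAt v).residueChar hpk hp2 hfin
  -- the module topology of `K_v` over `ℚ_p`: linear maps are continuous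
  haveI : ContinuousSMul ℚ_[(closureAt v).residueChar] (closureAt v).k :=
    continuousSMul_of_algebraMap ℚ_[(closureAt v).residueChar] _
      (by exact LocalField.continuous_algebraMap_adicCompletionPadicAlgebra v (closureAt v).residueChar hv)
  haveI : FiniteDimensional ℚ_[(closureAt v).residueChar] (closureAt v).k :=
    Module.finite_of_finrank_pos (by omega)
  -- coordinates of basis vectors
  have hba0 : y.coord b (y a) = 0 := by
    rw [Module.Basis.coord_apply, Module.Basis.repr_self, Finsupp.single_apply, if_neg hab]
  have hab0 : y.coord a (y b) = 0 := by
    rw [Module.Basis.coord_apply, Module.Basis.repr_self, Finsupp.single_apply, if_neg (Ne.symm hab)]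
  have haa : y.coord a (y a) = 1 := by
    rw [Module.Basis.coord_apply, Module.Basis.repr_self, Finsupp.single_apply, if_pos rfl]
  have hbb : y.coord b (y b) = 1 := by
    rw [Module.Basis.coord_apply, Module.Basis.repr_self, Finsupp.single_apply, if_pos rfl]
  -- the two transvections as linear automorphisms of `K_v`
  let T : (closureAt v).k ≃ₗ[ℚ_[(closureAt v).residueChar]] (closureAt v).k :=
    LinearEquiv.ofLinear (LinearMap.id + (y.coord b).smulRight (y a)) (LinearMap.id - (y.coord b).smulRight (y a))
      (by
        apply LinearMap.ext; intro x
        simp only [LinearMap.comp_apply, LinearMap.add_apply, LinearMap.sub_apply, LinearMap.id_apply,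
          LinearMap.smulRight_apply, map_sub, map_smul, hba0]
        rw [zero_smul, add_zero, add_sub_cancel_right])
      (by
        apply LinearMap.ext; intro x
        simp only [LinearMap.comp_apply, LinearMap.add_apply, LinearMap.sub_apply, LinearMap.id_apply,
          LinearMap.smulRight_apply, map_add, map_smul, hba0]
        rw [zero_smul, sub_zero, sub_add_cancel])
  let T' : (closureAt v).k ≃ₗ[ℚ_[(closureAt v).residueChar]] (closureAt v).k :=
    LinearEquiv.ofLinear (LinearMap.id - (y.coord a).smulRight (y b)) (LinearMap.id + (y.coord a).smulRight (y b))
      (by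
        apply LinearMap.ext; intro x
        simp only [LinearMap.comp_apply, LinearMap.add_apply, LinearMap.sub_apply, LinearMap.id_apply,
          LinearMap.smulRight_apply, map_add, map_smul, hab0]
        rw [zero_smul, sub_zero, sub_add_cancel])
      (by
        apply LinearMap.ext; intro x
        simp only [LinearMap.comp_apply, LinearMap.add_apply, LinearMap.sub_apply, LinearMap.id_apply,
          LinearMap.smulRight_apply, map_sub, map_smul, hab0]
        rw [zero_smul, add_zero, add_sub_cancel_right])
  have hTapply : ∀ x, T x = x + y.coord b x • y a := fun x => rfl
  have hT'apply : ∀ x, T' x = x - y.coord a x • y b := fun x => rfl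
  -- continuity (finite dimension over `ℚ_p`)
  have hcT : Continuous T.toAddEquiv := by exact T.toLinearMap.continuous_of_finiteDimensional
  have hcTs : Continuous T.toAddEquiv.symm := by exact T.symm.toLinearMap.continuous_of_finiteDimensional
  have hcT' : Continuous T'.toAddEquiv := by exact T'.toLinearMap.continuous_of_finiteDimensional
  have hcT's : Continuous T'.toAddEquiv.symm := by exact T'.symm.toLinearMap.continuous_of_finiteDimensional
  -- membership in print's (Ind1) strip part over the Galois logarithm
  have hψ : T.toAddEquiv ∈ ind1StripOf v (galoisLog v) :=
    ⟨hcT, hcTs, φ, realises_galoisLog_of_liftActsOnUnitLogAs v hpk φ _ hφ T.toAddEquiv hTapply⟩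
  have hψ' : T'.toAddEquiv ∈ ind1StripOf v (galoisLog v) :=
    ⟨hcT', hcT's, φ', realises_galoisLog_of_liftActsOnUnitLogAs v hpk φ' _ hφ' T'.toAddEquiv hT'apply⟩
  -- transport of the twist datum to the rescaled norm (`of` is the identity of `K_v`, `ℚ_p`-linear)
  let e := RescaledCompletion.of F (closureAt v).residueChar v hv
  let eL : (closureAt v).k ≃ₗ[ℚ_[(closureAt v).residueChar]] RescaledCompletion F (closureAt v).residueChar v hv :=
    { e.toAddEquiv with
      map_smul' := fun c x => by
        change e (c • x) = c • e x
        rw [Algebra.smul_def, Algebra.smul_def, map_mul]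
        rfl }
  have heL : ∀ x, eL x = e x := fun x => rfl
  have heLs : ∀ x, eL.symm x = e.symm x := fun x => rfl
  refine exists_mem_ind1StripOf_image_closedBall_ne (closureAt v).residueChar v hv hf (galoisLog v) hϖ
    (ca := (y.coord a).comp eL.symm.toLinearMap) (cb := (y.coord b).comp eL.symm.toLinearMap)
    (ya := eL (y a)) (yb := eL (y b)) ?_ ?_ ?_ hψ hψ' ?_ ?_
  · change y.coord a (eL.symm (eL (y a))) = 1
    rw [LinearEquiv.symm_apply_apply, haa]
  · change y.coord b (eL.symm (eL (y b))) = 1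
    rw [LinearEquiv.symm_apply_apply, hbb]
  · change y.coord b (eL.symm (eL (y a))) = 0
    rw [LinearEquiv.symm_apply_apply, hba0]
  · intro x
    change e (T (e.symm x)) = x + y.coord b (eL.symm x) • eL (y a)
    rw [hTapply, map_add, RingEquiv.apply_symm_apply, ← heL, ← heLs, map_smul]
  · intro x
    change e (T' (e.symm x)) = x - y.coord a (eL.symm x) • eL (y b)
    rw [hT'apply, map_sub, RingEquiv.apply_symm_apply, ← heL, ← heLs, map_smul]

/-- **The same over abc-iut-c312-5's ANALYTIC logarithm** (`Real.galoisLog_eq_analyticLogv`, w5-d216 p452975): assuming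
`DehnTwistTransvectionsOnUnits`, at every `v ∣ p` with `p` odd, `f(v|p) = 1`, `e(v|p) ≥ 3`, some
`χ ∈ Real.ind1StripOf v (analyticLogv F v)` and `m ∈ ℤ` have `χ(B(0,‖ϖ‖^m)) ≠ B(0,‖ϖ‖^m)`.
[claim: Mochizuki2012, status: disputed] [cite: Kondo2025OuterAutMLF, §2 Thm 2.1 and proof of Thm 2.3 p.10] -/
theorem exists_mem_ind1StripOf_analyticLogv_image_closedBall_ne_of_dehnTwistsOnUnits
    (hJW : DehnTwistTransvectionsOnUnits) (p : ℕ) [Fact p.Prime] (hv : ((p : ℕ) : 𝓞 F) ∈ v.asIdeal) (hp2 : p ≠ 2)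
    (hf : v.asIdeal.inertiaDeg ℤ = 1) (he : 3 ≤ v.asIdeal.ramificationIdx ℤ)
    {ϖ : (RescaledCompletion F p v hv)ˣ} (hϖ : IsUniformizer ϖ) :
    ∃ χ ∈ ind1StripOf v (analyticLogv F v), ∃ m : ℤ,
      (fun x => RescaledCompletion.of F p v hv (χ ((RescaledCompletion.of F p v hv).symm x))) ''
          closedBall (0 : RescaledCompletion F p v hv) (‖(ϖ : RescaledCompletion F p v hv)‖ ^ m) ≠
        closedBall (0 : RescaledCompletion F p v hv) (‖(ϖ : RescaledCompletion F p v hv)‖ ^ m) := by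
  rw [← galoisLog_eq_analyticLogv]
  exact exists_mem_ind1StripOf_galoisLog_image_closedBall_ne_of_dehnTwistsOnUnits v hJW p hv hp2 hf he hϖ

end Summit.ABC.IUTFork.Thm311.Real

end
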